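import Mathlib
import Literature.NumberTheory.LFunctions.WeilExplicitProofs
import Literature.NumberTheory.LFunctions.WeilMellinBounds
import Literature.NumberTheory.LFunctions.WeilGroundEnergyProofs
import Literature.NumberTheory.LFunctions.WeilGroundEnergyParitySplit
import Literature.NumberTheory.LFunctions.WeilOddGroundState
import Literature.NumberTheory.LFunctions.ZetaFirstZeroCertificate

/-!
# A Weil–Poincaré inequality under RH, and the parity comparison it yields

Work in the tree's additive normalisation (`Literature/NumberTheory/LFunctions/WeilExplicit.lean`):
test functions `IsWeilTest g` (smooth, compact support), `ĝ = weilMellin g`,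
`Q(g) = weilQuadratic g = W(g ⋆ g̃)`, even/odd window ground energies
`weilEvenGroundEnergy a`, `weilOddGroundEnergy a` (infima of `Re Q` over the even/odd unit
`L²`-spheres of tests supported in `[-a, a]`).

**The inequality.** Assume the Guinand–Weil explicit formula (the tree's named fact
`explicit_formula`) and the Riemann hypothesis. Then for EVERY test function `h`,

  `196 · Re Q(h) ≤ Re Q(h')`                                   (`soloBlind_weil_poincare`).

Proof: by the explicit formula `Re Q(h)` is the limit of the truncated zero sides
`Σ_{|Im ρ| ≤ T} m(ρ) (h ⋆ h̃)^(ρ)`; under RH each term is `m(ρ) |ĥ(ρ)|²`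
(`weilMellin_weilQuadratic_of_re_eq`), and `(h')^(ρ) = -(ρ - 1/2) ĥ(ρ)` (`weilMellin_deriv`), so the
term for `h'` is `m(ρ) |Im ρ|² |ĥ(ρ)|²`; finally `|Im ρ| > 14` for every zero of `ζ` off the real
axis, by the tree's kernel-certified `N(14) = 0` (`riemannZeta_ne_zero_of_im_pos_of_im_le_fourteen`).
So "the Weil form has a Poincaré inequality whose constant is the square of the first zero"
(`196 = 14²` here; the true constant is `γ₁² = 199.79…`).

**The parity comparison (Proposition A of the soloist's note `step1-parity.md`).** If `h` is an
EVEN test on the window `[-a, a]`, then `h'` is an ODD test on the same window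
(`soloBlind_deriv_odd_of_even`, `soloBlind_tsupport_deriv_subset`) and every odd test on the
window arises this way (its primitive is even and supported in the window). Normalising,

  `196 · ‖h‖₂² · ε_ev(a) ≤ Re Q(h')`                            (`soloBlind_weilEven_energy_le_deriv`),

i.e. for every odd test `g = h'`: `ε_ev(a) ≤ (Re Q(g)/‖g‖₂²) · R(g)/196` with
`R(g) := ‖g‖₂²/‖h‖₂² = ∫|ĝ|² dξ / ∫ |ĝ(ξ)|² ξ⁻² dξ`. Consequently

  `Re Q(h') < 196 · ‖h‖₂² · ε_od(a)  ⟹  ε_ev(a) < ε_od(a)`     (`soloBlind_weilEven_lt_odd_of_witness`):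

under RH the even sector wins the ground-state race at window `a` as soon as SOME odd test that is
near-minimising in the odd sector keeps its harmonic-mean-square frequency `R` below `14²` — an odd
function "wastes" a zero of its transform at frequency `0`, where `ζ` has none, and the price is at
least the factor `γ₁²/R`. This is the mechanism behind the numerically observed evenness of the
ground state of the truncated Weil form (Connes–Consani–Moscovici 2025, Step 1 of their programme);
the soloist's two-engine Ritz computations give `R ≈ 3.09/a²` for `a ≤ 0.35` and `R = 16.0, 12.9,
11.6` at `a = 0.5, 0.75, 1.0` for the odd Ritz ground state, so the witness condition holds with a
margin `196/R` between `1.4` (`a = 0.15`) and `17` (`a = 1`), and cannot hold for `a ≤ π/28 = 0.112`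
(`R ≥ (π/2a)²` for every odd `g`, the Dirichlet eigenvalue of the primitive).

What is NOT proved here: that an odd minimising sequence with `R < 196` exists (a localisation
statement about near-minimisers of the concentration problem for the set of zeros; open), and the
simplicity half of Step 1. Everything is downstream of RH; no claim toward RH is made.

Soloist `solo-RiemannHypothesis-blind`, session 5 (2026-08-17). [problem: rh]
-/

noncomputable section

open Complex Filter Set MeasureTheory
open scoped Real Topology ComplexConjugate

namespace Summit.RiemannHypothesis.RiemannHypothesis.Theorems

open Literature.NumberTheory.LFunctions

/-! ## The first zero: `|Im ρ| > 14` for every zero of `ζ` off the real axis -/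

/-- Every zero of `ζ` with `Im ρ ≠ 0` has `|Im ρ| > 14` (the tree's certified `N(14) = 0`,
`riemannZeta_ne_zero_of_im_pos_of_im_le_fourteen`, plus conjugation symmetry `riemannZeta_conj`).
[folklore] -/
theorem soloBlind_fourteen_lt_abs_im_of_zero {ρ : ℂ} (hζ : riemannZeta ρ = 0) (him : ρ.im ≠ 0) :
    14 < |ρ.im| := by
  by_contra h
  rw [not_lt] at h
  rcases lt_or_gt_of_ne him with hneg | hpos
  · have hc : riemannZeta (conj ρ) = 0 := by rw [riemannZeta_conj, hζ, map_zero]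
    have h0 : 0 < (conj ρ).im := by rw [conj_im]; linarith
    have h14 : (conj ρ).im ≤ 14 := by
      rw [conj_im]
      rw [abs_of_neg hneg] at h
      exact h
    exact riemannZeta_ne_zero_of_im_pos_of_im_le_fourteen h0 h14 hc
  · have h14 : ρ.im ≤ 14 := by
      rw [abs_of_pos hpos] at h
      exact h
    exact riemannZeta_ne_zero_of_im_pos_of_im_le_fourteen hpos h14 hζ

/-- Under RH, `196 ≤ |ρ - 1/2|²` for every zero `ρ` of `ζ` off the real axis. [folklore] -/
theorem soloBlind_normSq_sub_half_ge (hRH : _root_.RiemannHypothesis) {ρ : ℂ}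
    (hζ : riemannZeta ρ = 0) (him : ρ.im ≠ 0) : 196 ≤ Complex.normSq (ρ - 1 / 2) := by
  have hre : ρ.re = 1 / 2 := by
    -- under RH: `ρ` is a non-trivial zero (`Im ρ ≠ 0`) and `ρ ≠ 1`
    have hne1 : ρ ≠ 1 := by
      rintro rfl
      simp at him
    refine hRH ρ hζ ?_ hne1
    rintro ⟨n, rfl⟩
    simp at him
  have h14 : 14 < |ρ.im| := soloBlind_fourteen_lt_abs_im_of_zero hζ him
  have hρI : ρ - 1 / 2 = (ρ.im : ℂ) * I := by
    apply Complex.ext <;> simp [hre]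
  rw [hρI, Complex.normSq_mul, Complex.normSq_I, Complex.normSq_ofReal, mul_one]
  have habs : |ρ.im| * |ρ.im| = ρ.im * ρ.im := abs_mul_abs_self ρ.im
  nlinarith [abs_nonneg ρ.im]

/-! ## Termwise and truncated comparison of the zero sides of `Q(h)` and `Q(h')` -/

/-- Termwise, under RH: `196 · Re (m(ρ) (h ⋆ h̃)^(ρ)) ≤ Re (m(ρ) (h' ⋆ h̃')^(ρ))` at every zero `ρ`
off the real axis, because both are `m(ρ) · (1, resp. |ρ - 1/2|²) · |ĥ(ρ)|²`. [folklore] -/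
theorem soloBlind_zeroSide_term_le (hRH : _root_.RiemannHypothesis) {h : ℝ → ℂ}
    (hh : IsWeilTest h) {ρ : ℂ} (hζ : riemannZeta ρ = 0) (him : ρ.im ≠ 0) :
    196 * ((riemannZetaZeroOrder ρ : ℂ) * weilMellin (weilConv h (weilReflect h)) ρ).re ≤
      ((riemannZetaZeroOrder ρ : ℂ) *
        weilMellin (weilConv (deriv h) (weilReflect (deriv h))) ρ).re := by
  have hre : ρ.re = 1 / 2 := by
    -- under RH: `ρ` is a non-trivial zero (`Im ρ ≠ 0`) and `ρ ≠ 1`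
    have hne1 : ρ ≠ 1 := by
      rintro rfl
      simp at him
    refine hRH ρ hζ ?_ hne1
    rintro ⟨n, rfl⟩
    simp at him
  have hne : ρ ≠ 1 := by
    rintro rfl
    simp at him
  have hm : (0 : ℝ) ≤ (riemannZetaZeroOrder ρ : ℝ) := by
    exact_mod_cast riemannZetaZeroOrder_nonneg hne
  rw [weilMellin_weilQuadratic_of_re_eq hh hre, weilMellin_weilQuadratic_of_re_eq hh.deriv hre,
    weilMellin_deriv hh, Complex.normSq_mul, Complex.normSq_neg]
  have key : ∀ x : ℝ, ((riemannZetaZeroOrder ρ : ℂ) * (x : ℂ)).re =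
      (riemannZetaZeroOrder ρ : ℝ) * x := by
    intro x
    rw [← Complex.ofReal_intCast, ← Complex.ofReal_mul, Complex.ofReal_re]
  rw [key, key]
  have hsq : (196 : ℝ) ≤ Complex.normSq (ρ - 1 / 2) := soloBlind_normSq_sub_half_ge hRH hζ him
  have hn : 0 ≤ Complex.normSq (weilMellin h ρ) := Complex.normSq_nonneg _
  have hmn : 0 ≤ (riemannZetaZeroOrder ρ : ℝ) * Complex.normSq (weilMellin h ρ) := mul_nonneg hm hn
  calc 196 * ((riemannZetaZeroOrder ρ : ℝ) * Complex.normSq (weilMellin h ρ))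
      = ((riemannZetaZeroOrder ρ : ℝ) * Complex.normSq (weilMellin h ρ)) * 196 := by ring
    _ ≤ ((riemannZetaZeroOrder ρ : ℝ) * Complex.normSq (weilMellin h ρ)) *
          Complex.normSq (ρ - 1 / 2) := mul_le_mul_of_nonneg_left hsq hmn
    _ = (riemannZetaZeroOrder ρ : ℝ) *
          (Complex.normSq (ρ - 1 / 2) * Complex.normSq (weilMellin h ρ)) := by ring

/-- Truncated zero sides, under RH: `196 · Re Σ_{|Im ρ| ≤ T} m(ρ)(h ⋆ h̃)^(ρ) ≤ Re Σ_{|Im ρ| ≤ T} m(ρ)(h' ⋆ h̃')^(ρ)`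
for every `T` (finite sums over `weilZeroIndex T`; termwise `soloBlind_zeroSide_term_le`). [folklore] -/
theorem soloBlind_weilZeroSidePartial_deriv_ge (hRH : _root_.RiemannHypothesis) {h : ℝ → ℂ}
    (hh : IsWeilTest h) (T : ℝ) :
    196 * (weilZeroSidePartial (weilConv h (weilReflect h)) T).re ≤
      (weilZeroSidePartial (weilConv (deriv h) (weilReflect (deriv h))) T).re := by
  unfold weilZeroSidePartial
  rw [finsum_mem_eq_finite_toFinset_sum _ (weilZeroIndex_finite T),
    finsum_mem_eq_finite_toFinset_sum _ (weilZeroIndex_finite T),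
    Complex.re_sum, Complex.re_sum, Finset.mul_sum]
  refine Finset.sum_le_sum fun ρ hρ ↦ ?_
  obtain ⟨hζ, -, -, him, -⟩ := (Set.Finite.mem_toFinset _).1 hρ
  exact soloBlind_zeroSide_term_le hRH hh hζ him

/-! ## The Weil–Poincaré inequality -/

/-- **Weil–Poincaré inequality under RH.** Assuming the explicit formula (named fact
`explicit_formula`) and the Riemann hypothesis, `196 · Re Q(h) ≤ Re Q(h')` for every test function
`h`: pass to the limit `T → ∞` in `soloBlind_weilZeroSidePartial_deriv_ge`. The constant is
`14² = 196` from the certified `N(14) = 0`; morally it is `γ₁² = 199.79…`. [folklore] -/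
theorem soloBlind_weil_poincare (hEF : explicit_formula) (hRH : _root_.RiemannHypothesis)
    {h : ℝ → ℂ} (hh : IsWeilTest h) :
    196 * (weilQuadratic h).re ≤ (weilQuadratic (deriv h)).re := by
  have hk : IsWeilTest (weilConv h (weilReflect h)) := hh.weilConv hh.weilReflect
  have hk' : IsWeilTest (weilConv (deriv h) (weilReflect (deriv h))) :=
    hh.deriv.weilConv hh.deriv.weilReflect
  have hlim : Tendsto (fun T ↦ 196 * (weilZeroSidePartial (weilConv h (weilReflect h)) T).re)
      atTop (𝓝 (196 * (weilQuadratic h).re)) :=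
    ((Complex.continuous_re.tendsto _).comp (hEF hk)).const_mul 196
  have hlim' : Tendsto
      (fun T ↦ (weilZeroSidePartial (weilConv (deriv h) (weilReflect (deriv h))) T).re) atTop
      (𝓝 (weilQuadratic (deriv h)).re) :=
    (Complex.continuous_re.tendsto _).comp (hEF hk')
  exact le_of_tendsto_of_tendsto' hlim hlim' fun T ↦
    soloBlind_weilZeroSidePartial_deriv_ge hRH hh T

/-- Iterated: `196^k · Re Q(h) ≤ Re Q(h^{(k)})` under RH. [folklore] -/
theorem soloBlind_weil_poincare_iterate (hEF : explicit_formula) (hRH : _root_.RiemannHypothesis)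
    (k : ℕ) : ∀ {h : ℝ → ℂ}, IsWeilTest h →
      196 ^ k * (weilQuadratic h).re ≤ (weilQuadratic (deriv^[k] h)).re := by
  induction k with
  | zero => intro h _; simp
  | succ k ih =>
    intro h hh
    have h1 := ih hh.deriv
    have h2 := soloBlind_weil_poincare hEF hRH hh
    rw [Function.iterate_succ, Function.comp_apply]
    calc 196 ^ (k + 1) * (weilQuadratic h).re = 196 ^ k * (196 * (weilQuadratic h).re) := by ring
      _ ≤ 196 ^ k * (weilQuadratic (deriv h)).re :=
          mul_le_mul_of_nonneg_left h2 (by positivity)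
      _ ≤ (weilQuadratic (deriv^[k] (deriv h))).re := h1

/-! ## Parity: the derivative of an even window test is an odd window test -/

/-- The derivative of an even test function is odd. [folklore] -/
theorem soloBlind_deriv_odd_of_even {h : ℝ → ℂ} (hh : IsWeilTest h) (hev : ∀ t, h (-t) = h t)
    (t : ℝ) : deriv h (-t) = -deriv h t := by
  have hd : ∀ x, HasDerivAt h (deriv h x) x := fun x ↦
    (hh.1.differentiable (by simp) x).hasDerivAt
  have h1 : HasDerivAt (fun x ↦ h (-x)) ((-1 : ℝ) • deriv h (-t)) t :=
    (hd (-t)).scomp t (hasDerivAt_neg t)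
  have hfun : (fun x ↦ h (-x)) = h := funext hev
  rw [hfun] at h1
  rw [h1.deriv, neg_one_smul, neg_neg]

/-- The derivative of an odd test function is even. [folklore] -/
theorem soloBlind_deriv_even_of_odd {h : ℝ → ℂ} (hh : IsWeilTest h) (hodd : ∀ t, h (-t) = -h t)
    (t : ℝ) : deriv h (-t) = deriv h t := by
  have hd : ∀ x, HasDerivAt h (deriv h x) x := fun x ↦
    (hh.1.differentiable (by simp) x).hasDerivAt
  have h1 : HasDerivAt (fun x ↦ h (-x)) ((-1 : ℝ) • deriv h (-t)) t :=
    (hd (-t)).scomp t (hasDerivAt_neg t)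
  have hfun : (fun x ↦ h (-x)) = fun x ↦ -h x := funext hodd
  rw [hfun] at h1
  have h2 : HasDerivAt (fun x ↦ -h x) (-deriv h t) t := (hd t).neg
  have := h1.unique h2
  rw [neg_one_smul, neg_inj] at this
  exact this

/-- The derivative of a test supported in the window is supported in the window. [folklore] -/
theorem soloBlind_tsupport_deriv_subset {h : ℝ → ℂ} {a : ℝ} (hsupp : tsupport h ⊆ Icc (-a) a) :
    tsupport (deriv h) ⊆ Icc (-a) a :=
  (closure_minimal support_deriv_subset (isClosed_tsupport h)).trans hsupp

/-! ## Rayleigh-quotient bounds for the sector energies -/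

/-- `ε_ev(a) ≤ Re Q(h)/‖h‖₂²` for every even test `h ≠ 0` on the window (normalise; `Q(c h) = |c|² Q(h)`;
even twin of the tree's `weilGroundEnergy_le_div`). [folklore] -/
theorem soloBlind_weilEvenGroundEnergy_le_div {h : ℝ → ℂ} (hh : IsWeilTest h) {a : ℝ}
    (hsupp : tsupport h ⊆ Icc (-a) a) (hev : ∀ t, h (-t) = h t)
    (hpos : 0 < ∫ t : ℝ, ‖h t‖ ^ 2) :
    weilEvenGroundEnergy a ≤ (weilQuadratic h).re / ∫ t : ℝ, ‖h t‖ ^ 2 := by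
  set N2 : ℝ := ∫ t : ℝ, ‖h t‖ ^ 2 with hN2
  set c : ℝ := (Real.sqrt N2)⁻¹ with hc
  have hcpos : 0 < c := inv_pos.2 (Real.sqrt_pos.2 hpos)
  have hh't : IsWeilTest fun t ↦ (c : ℂ) * h t := hh.const_mul c
  have hsupp' : tsupport (fun t ↦ (c : ℂ) * h t) ⊆ Icc (-a) a :=
    tsupport_mul_subset_right.trans hsupp
  have hev' : ∀ t, (fun t ↦ (c : ℂ) * h t) (-t) = (fun t ↦ (c : ℂ) * h t) t := fun t ↦ by
    show (c : ℂ) * h (-t) = (c : ℂ) * h t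
    rw [hev]
  have hnorm' : ∫ t : ℝ, ‖(c : ℂ) * h t‖ ^ 2 = 1 := by
    simp only [norm_mul, mul_pow, Complex.norm_real, Real.norm_of_nonneg hcpos.le]
    rw [integral_const_mul, hc, inv_pow, Real.sq_sqrt hpos.le, inv_mul_cancel₀ hpos.ne']
  have hle : weilEvenGroundEnergy a ≤ (weilQuadratic fun t ↦ (c : ℂ) * h t).re :=
    weilEvenGroundEnergy_le hh't hsupp' hev' hnorm'
  have hQ' : (weilQuadratic fun t ↦ (c : ℂ) * h t).re = c * c * (weilQuadratic h).re := by
    rw [weilQuadratic_const_mul, Complex.normSq_ofReal, Complex.re_ofReal_mul]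
  have hcc : c * c = 1 / N2 := by
    rw [hc, ← mul_inv, Real.mul_self_sqrt hpos.le, one_div]
  rw [hQ', hcc] at hle
  simpa only [one_div, inv_mul_eq_div] using hle

/-- `ε_od(a) ≤ Re Q(g)/‖g‖₂²` for every odd test `g ≠ 0` on the window (odd twin). [folklore] -/
theorem soloBlind_weilOddGroundEnergy_le_div {g : ℝ → ℂ} (hg : IsWeilTest g) {a : ℝ}
    (hsupp : tsupport g ⊆ Icc (-a) a) (hodd : ∀ t, g (-t) = -g t)
    (hpos : 0 < ∫ t : ℝ, ‖g t‖ ^ 2) :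
    weilOddGroundEnergy a ≤ (weilQuadratic g).re / ∫ t : ℝ, ‖g t‖ ^ 2 := by
  set N2 : ℝ := ∫ t : ℝ, ‖g t‖ ^ 2 with hN2
  set c : ℝ := (Real.sqrt N2)⁻¹ with hc
  have hcpos : 0 < c := inv_pos.2 (Real.sqrt_pos.2 hpos)
  have hg't : IsWeilTest fun t ↦ (c : ℂ) * g t := hg.const_mul c
  have hsupp' : tsupport (fun t ↦ (c : ℂ) * g t) ⊆ Icc (-a) a :=
    tsupport_mul_subset_right.trans hsupp
  have hodd' : ∀ t, (fun t ↦ (c : ℂ) * g t) (-t) = -(fun t ↦ (c : ℂ) * g t) t := fun t ↦ by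
    show (c : ℂ) * g (-t) = -((c : ℂ) * g t)
    rw [hodd, mul_neg]
  have hnorm' : ∫ t : ℝ, ‖(c : ℂ) * g t‖ ^ 2 = 1 := by
    simp only [norm_mul, mul_pow, Complex.norm_real, Real.norm_of_nonneg hcpos.le]
    rw [integral_const_mul, hc, inv_pow, Real.sq_sqrt hpos.le, inv_mul_cancel₀ hpos.ne']
  have hle : weilOddGroundEnergy a ≤ (weilQuadratic fun t ↦ (c : ℂ) * g t).re :=
    weilOddGroundEnergy_le hg't hsupp' hodd' hnorm'
  have hQ' : (weilQuadratic fun t ↦ (c : ℂ) * g t).re = c * c * (weilQuadratic g).re := by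
    rw [weilQuadratic_const_mul, Complex.normSq_ofReal, Complex.re_ofReal_mul]
  have hcc : c * c = 1 / N2 := by
    rw [hc, ← mul_inv, Real.mul_self_sqrt hpos.le, one_div]
  rw [hQ', hcc] at hle
  simpa only [one_div, inv_mul_eq_div] using hle

/-! ## Proposition A: the parity comparison -/

/-- **Proposition A (evenness lever).** Under the explicit formula and RH: for every EVEN test `h`
on the window `[-a, a]` with `‖h‖₂ > 0`,
`196 · ‖h‖₂² · ε_ev(a) ≤ Re Q(h')`, where `h'` is an ODD test on the same window
(`soloBlind_deriv_odd_of_even`, `soloBlind_tsupport_deriv_subset`). In Rayleigh form, for the odd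
test `g = h'`: `ε_ev(a) ≤ (Re Q(g)/‖g‖₂²) · (‖g‖₂²/‖h‖₂²)/196`. [folklore] -/
theorem soloBlind_weilEven_energy_le_deriv (hEF : explicit_formula) (hRH : _root_.RiemannHypothesis)
    {a : ℝ} {h : ℝ → ℂ} (hh : IsWeilTest h) (hsupp : tsupport h ⊆ Icc (-a) a)
    (hev : ∀ t, h (-t) = h t) (hpos : 0 < ∫ t : ℝ, ‖h t‖ ^ 2) :
    196 * (∫ t : ℝ, ‖h t‖ ^ 2) * weilEvenGroundEnergy a ≤ (weilQuadratic (deriv h)).re := by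
  have h1 := soloBlind_weilEvenGroundEnergy_le_div hh hsupp hev hpos
  rw [le_div_iff₀ hpos] at h1
  have h2 := soloBlind_weil_poincare hEF hRH hh
  calc 196 * (∫ t : ℝ, ‖h t‖ ^ 2) * weilEvenGroundEnergy a
      = 196 * (weilEvenGroundEnergy a * ∫ t : ℝ, ‖h t‖ ^ 2) := by ring
    _ ≤ 196 * (weilQuadratic h).re := by linarith
    _ ≤ (weilQuadratic (deriv h)).re := h2

/-- **Corollary (the even sector wins, given one odd witness).** Under the explicit formula and RH:
if some even test `h` on the window has `Re Q(h') < 196 · ‖h‖₂² · ε_od(a)` — equivalently the odd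
test `g = h'` satisfies `(Re Q(g)/‖g‖₂²) · R(g) < 196 · ε_od(a)` with `R(g) = ‖g‖₂²/‖h‖₂²`, which for
a near-minimising odd `g` means `R(g) < 196 (1 - o(1))` — then `ε_ev(a) < ε_od(a)`: the ground
state of the truncated Weil form at window `a`, if it exists, is not odd. [folklore] -/
theorem soloBlind_weilEven_lt_odd_of_witness (hEF : explicit_formula)
    (hRH : _root_.RiemannHypothesis) {a : ℝ} {h : ℝ → ℂ} (hh : IsWeilTest h)
    (hsupp : tsupport h ⊆ Icc (-a) a) (hev : ∀ t, h (-t) = h t)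
    (hpos : 0 < ∫ t : ℝ, ‖h t‖ ^ 2)
    (hlt : (weilQuadratic (deriv h)).re < 196 * (∫ t : ℝ, ‖h t‖ ^ 2) * weilOddGroundEnergy a) :
    weilEvenGroundEnergy a < weilOddGroundEnergy a := by
  have h1 := soloBlind_weilEven_energy_le_deriv hEF hRH hh hsupp hev hpos
  have h3 : 196 * (∫ t : ℝ, ‖h t‖ ^ 2) * weilEvenGroundEnergy a <
      196 * (∫ t : ℝ, ‖h t‖ ^ 2) * weilOddGroundEnergy a := h1.trans_lt hlt
  exact lt_of_mul_lt_mul_left h3 (by positivity)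

/-- The witness condition compares like with like: `h'` is itself an admissible odd test on the
window, so `ε_od(a) ≤ Re Q(h')/‖h'‖₂²` whenever `h' ≠ 0`; the corollary therefore fires exactly when
`(Re Q(h')/‖h'‖₂²)/ε_od(a) · R < 196`, `R = ‖h'‖₂²/‖h‖₂²`. [folklore] -/
theorem soloBlind_weilOddGroundEnergy_le_deriv {a : ℝ} {h : ℝ → ℂ} (hh : IsWeilTest h)
    (hsupp : tsupport h ⊆ Icc (-a) a) (hev : ∀ t, h (-t) = h t)
    (hpos : 0 < ∫ t : ℝ, ‖deriv h t‖ ^ 2) :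
    weilOddGroundEnergy a ≤ (weilQuadratic (deriv h)).re / ∫ t : ℝ, ‖deriv h t‖ ^ 2 :=
  soloBlind_weilOddGroundEnergy_le_div hh.deriv (soloBlind_tsupport_deriv_subset hsupp)
    (soloBlind_deriv_odd_of_even hh hev) hpos

end Summit.RiemannHypothesis.RiemannHypothesis.Theorems

end
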